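import Mathlib

/-!
# GFC — Gaussian-frame compression maps for the KSDN lower hierarchy (crux idea on
`Summit.Ventures.CertifiedManyBodySolver.Theses.M3PrimeEdgeSplit.LowerEdge_ge_m4o5`), first-lemma sketch.

The relaxation's VALIDITY is independent of the coarse-graining maps; only its TIGHTNESS depends on
them.  The first checkable statement of the line is the one-step soundness of compressing a PSD
window marginal by an arbitrary frame `V` (here: a truncated Gaussian = DMET-bath Schmidt frame),
and the monotonicity of the compressed relaxation value in the frame (a bigger frame can only
tighten).  Both are finite-dimensional linear algebra over Mathlib's `Matrix.PosSemidef`.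
-/

namespace Summit.Ventures.CertifiedManyBodySolver.Cruxes.LowerEdge_ge_m4o5.GFC

open Matrix
open scoped ComplexOrder

/-- One compression step is sound for ANY frame: `Vᴴ ρ V ⪰ 0` whenever `ρ ⪰ 0`.
(Bath truncation = choice of `V`; it can lose constraints, never validity.) -/
theorem compress_posSemidef {n k : Type*} [Fintype n] [Fintype k]
    (ρ : Matrix n n ℂ) (hρ : ρ.PosSemidef) (V : Matrix n k ℂ) :
    (Vᴴ * ρ * V).PosSemidef :=
  hρ.conjTranspose_mul_mul_same V

/-- Nesting: compressing by `V` and then by `W` is compressing by the product frame `V * W`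
(the KSDN compatibility of iterated Gaussian Schmidt frames along a snake/column growth). -/
theorem compress_compress {n k l : Type*} [Fintype n] [Fintype k] [Fintype l]
    (ρ : Matrix n n ℂ) (V : Matrix n k ℂ) (W : Matrix k l ℂ) :
    Wᴴ * (Vᴴ * ρ * V) * W = (V * W)ᴴ * ρ * (V * W) := by
  simp only [conjTranspose_mul, Matrix.mul_assoc]

/-- The relaxation schema in one line: if every state-feasible point is relaxation-feasible
(`feasible ρ → relaxed ρ`) then the relaxed minimum is a lower bound of the true minimum.
Stated over an abstract objective `E`; this is the shape of the certificate the line would land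
(`c ≤ E ρ` for all relaxation-feasible `ρ` ⇒ `c ≤ E ρ` for all physical `ρ`). -/
theorem relaxed_bound_is_bound {α : Type*} (feasible relaxed : α → Prop) (E : α → ℝ) (c : ℝ)
    (hsound : ∀ ρ, feasible ρ → relaxed ρ) (hcert : ∀ ρ, relaxed ρ → c ≤ E ρ) :
    ∀ ρ, feasible ρ → c ≤ E ρ :=
  fun ρ h => hcert ρ (hsound ρ h)

end Summit.Ventures.CertifiedManyBodySolver.Cruxes.LowerEdge_ge_m4o5.GFC
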